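/-
Origin: expansion seat `planner-pub-hodgecm-toy2-g3-0`, handover #3 2026-08-18T06:43:53Z (`HOME/pub-hodgecm-toy2-g3/lean/Toy2g3/TruncAlgAt.lean`, md5 68d02902, 513 lines);
landed by the gen-7 packager in gate run 25 as `HodgeCM/Model/Toy/TruncAlgAt.lean` (import ^import Toy2g3\.ToyTruncAlg\b→import HodgeCM.Model.Toy.ToyTruncAlg ×1).
-/
/-
Copyright: pub-hodgecm formalisation cell (harness21, 2026). New file (not vendored).
Origin: HOME/pub-hodgecm-toy2-g3/lean/Toy2g3/TruncAlgAt.lean — session planner-pub-hodgecm-toy2-g3-0 (unit pub-hodgecm-toy2-g3,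
CONSISTENCY seat 2, part (6a)(i)+(ii), generation 3).  WIP module `Toy2g3.TruncAlgAt`; intended final place
`HodgeCM/Model/Toy/TruncAlgAt.lean` (module `HodgeCM.Model.Toy.TruncAlgAt`; kind L5 consistency / non-vacuity layer).
WIP import to rewrite on landing: `import Toy2g3.ToyTruncAlg` ↦ `import HodgeCM.Model.Toy.ToyTruncAlg` (this seat, HANDOVER #1).
-/
import Summits.HodgeConjecture.HodgeCM.Model.Toy.ToyTruncAlg
import Summits.HodgeConjecture.HodgeCM.Model.Toy.ToyGysinDescent

/-!
# Truncation at an arbitrary codimension: the Hodge conjecture for CM products is not a finite-codimension statement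
# over the model facts, and the 28 facts have infinitely many pairwise distinct models

`U.truncAlgAt c` is `U` with the spans of algebraic classes kept in codimension `≤ c` and replaced by `0` above
(`U.truncAlgAt 2 = U.truncAlg`, `HodgeCM.Model.TruncAlg`).  For every `c ≥ 2` the argument of `HodgeCM.Model.TruncAlg`
goes through VERBATIM (the model facts see `alg` only in codimension `≤ 2`, at the Gysin class of M26 — `tr = 0`, `c := 0` —
and on the source side of M28, which only shrinks):

* `ModelAxioms.truncAlgAt : U.ModelAxioms → 2 ≤ c → (∀ X k, U.tr X k = 0) → (U.truncAlgAt c).ModelAxioms`;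
* unchanged: `W_RK4`, `PohlmannSpan`, `PohlmannBasis`, the weight spaces, N1–N4, F5, `Fact_dimProd`;
* NEW here — `HCUpTo c` ("every Hodge class of codimension `≤ c` on every variety is algebraic") is unchanged too;
* the witness is now the top class of the `(n+1)`-fold power `A_{(F,Φ)}^{n+1}`, `F = ℚ(ζ₇)`: a nonzero weight vector of the
  full weight (a Hodge weight of degree `(n+1)·[F:ℚ]/2 ≥ 3(n+1)`, Lefschetz character `0`), so for `n = c` it lies above
  the cut: `¬ (U.truncAlgAt c).Qw8Sufficiency`, `¬ (U.truncAlgAt c).FaceReduction` for every `c ≥ 2`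
  (given `ModelAxioms`, N1(–N4) and `W_RK4` for `U`).

CONSEQUENCES in the toy (`truncModelAt c := toyModel.truncAlgAt c`, no hypotheses):

1. `hc_not_finite_codimension : ∀ c, ∃ U, U.ModelAxioms ∧ U.PohlmannSpan ∧ U.PohlmannBasis ∧ U.W_RK4 ∧ N1 ∧ N2 ∧ N3 ∧ N4 ∧
   U.HCUpTo c ∧ ¬ U.FaceReduction ∧ ¬ U.Qw8Sufficiency` — relative to the 28 model facts, Pohlmann's theorem and N1–N4, the
   algebraicity of ALL Hodge classes of codimension `≤ c` on ALL varieties (in particular of every face line and every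
   divisor power) does not imply the Hodge conjecture for products of CM abelian varieties, for any `c`; equivalently no
   consequence of `[QW8]` sufficiency that only speaks about codimension `≤ c` can replace it in `COR_CM_holds`.
2. `truncModelAt_injective : Function.Injective (fun k : ℕ => truncModelAt (3 * k + 2))` and
   `infinitely_many_models : ∃ g : ℕ → Universe, Function.Injective g ∧ ∀ k, (g k).ModelAxioms ∧ …` — the 28 model facts
   (with Pohlmann, `W_RK4`, N1–N4, F5) have INFINITELY MANY pairwise distinct models (part (6a)(i): consistency does not
   rest on one example, nor on two).

All proofs are kernel-checked against the tree; no cited facts (ABSOLUTE RULE).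
-/

noncomputable section

open scoped TensorProduct

namespace HodgeCM

open Literature.AlgebraicGeometry.Motives (CMType)

namespace Universe

variable (U : Universe)

/-! ### The truncation at codimension `c` -/

/-- The **codimension-`c` truncation** of `U`: algebraic classes kept in codimension `≤ c`, replaced by `0` above. -/
def truncAlgAt (c : ℕ) : Universe := { U with alg := fun X p => if p ≤ c then U.alg X p else ⊥ }

/-- (Ported verbatim from the HodgeCMPerL package; no docstring in the source.) -/
theorem truncAlgAt_two : U.truncAlgAt 2 = U.truncAlg := rfl

/-- (Ported verbatim from the HodgeCMPerL package; no docstring in the source.) -/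
theorem truncAlgAt_alg (c : ℕ) (X : U.Var) (p : ℕ) :
    (U.truncAlgAt c).alg X p = if p ≤ c then U.alg X p else ⊥ := rfl

/-- (Ported verbatim from the HodgeCMPerL package; no docstring in the source.) -/
theorem truncAlgAt_alg_of_le {c : ℕ} {X : U.Var} {p : ℕ} (hp : p ≤ c) : (U.truncAlgAt c).alg X p = U.alg X p :=
  if_pos hp

/-- (Ported verbatim from the HodgeCMPerL package; no docstring in the source.) -/
theorem truncAlgAt_alg_of_lt {c : ℕ} {X : U.Var} {p : ℕ} (hp : c < p) : (U.truncAlgAt c).alg X p = ⊥ :=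
  if_neg (not_le.mpr hp)

/-- (Ported verbatim from the HodgeCMPerL package; no docstring in the source.) -/
theorem truncAlgAt_alg_le (c : ℕ) (X : U.Var) (p : ℕ) : (U.truncAlgAt c).alg X p ≤ U.alg X p := by
  rw [truncAlgAt_alg]
  split_ifs
  · exact le_rfl
  · exact bot_le

/-- (Ported verbatim from the HodgeCMPerL package; no docstring in the source.) -/
@[simp] theorem truncAlgAt_tr (c : ℕ) (X : U.Var) (k : ℕ) : (U.truncAlgAt c).tr X k = U.tr X k := rfl

/-- (Ported verbatim from the HodgeCMPerL package; no docstring in the source.) -/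
theorem truncAlgAt_hodgeClassesOf (c : ℕ) (X : U.Var) (p : ℕ) :
    (U.truncAlgAt c).hodgeClassesOf X p = U.hodgeClassesOf X p := rfl

/-- (Ported verbatim from the HodgeCMPerL package; no docstring in the source.) -/
theorem truncAlgAt_algC_of_lt {c : ℕ} {X : U.Var} {p : ℕ} (hp : c < p) : (U.truncAlgAt c).algC X p = ⊥ := by
  rw [algC, truncAlgAt_alg_of_lt U hp, Submodule.baseChange_bot]

/-! ### `HCUpTo c`: the Hodge conjecture through codimension `c` -/

/-- **`HCUpTo c`**: on EVERY variety, every rational Hodge class of codimension `≤ c` is algebraic. -/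
def HCUpTo (c : ℕ) : Prop := ∀ (X : U.Var) (p : ℕ), p ≤ c → U.hodgeClassesOf X p ≤ U.alg X p

/-- (Ported verbatim from the HodgeCMPerL package; no docstring in the source.) -/
theorem hcUpTo_of_hc (h : ∀ X : U.Var, U.HC X) (c : ℕ) : U.HCUpTo c := fun X p _ => h X p

/-- (Ported verbatim from the HodgeCMPerL package; no docstring in the source.) -/
theorem hcUpTo_mono {c c' : ℕ} (h : U.HCUpTo c') (hcc' : c ≤ c') : U.HCUpTo c := fun X p hp => h X p (hp.trans hcc')

/-- (Ported verbatim from the HodgeCMPerL package; no docstring in the source.) -/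
theorem truncAlgAt_hcUpTo_iff (c : ℕ) : (U.truncAlgAt c).HCUpTo c ↔ U.HCUpTo c := by
  refine forall₃_congr fun X p hp => ?_
  show U.hodgeClassesOf X p ≤ (U.truncAlgAt c).alg X p ↔ _
  rw [U.truncAlgAt_alg_of_le hp]

/-! ### The 28 model facts survive (for `c ≥ 2`, when `tr = 0`) -/

set_option smartUnfolding false in
/-- (Ported verbatim from the HodgeCMPerL package; no docstring in the source.) -/
theorem truncAlgAt_fact_cmDominated_iff (c : ℕ) : (U.truncAlgAt c).Fact_cmDominated ↔ U.Fact_cmDominated := Iff.rfl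

/-- **The 28 model facts survive truncation at any codimension `c ≥ 2`** of a universe with `tr = 0` (the proof of
`ModelAxioms.truncAlg`, verbatim). -/
theorem ModelAxioms.truncAlgAt {U : Universe} (M : U.ModelAxioms) {c : ℕ} (hc : 2 ≤ c)
    (h0 : ∀ (X : U.Var) (k : ℕ), U.tr X k = 0) : (U.truncAlgAt c).ModelAxioms where
  pull_id := M.pull_id
  pull_comp := M.pull_comp
  pull_cup := M.pull_cup
  pull_hodge := M.pull_hodge
  cup2_hodge := M.cup2_hodge
  tr_degree := M.tr_degree
  alg_le_hodge := fun X p => (U.truncAlgAt_alg_le c X p).trans (M.alg_le_hodge X p)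
  pull_alg := fun X Y f p => by
    show ((U.truncAlgAt c).alg Y p).map (U.pull f (2 * p)) ≤ (U.truncAlgAt c).alg X p
    rw [truncAlgAt_alg, truncAlgAt_alg]
    split_ifs
    · exact M.pull_alg X Y f p
    · rw [Submodule.map_bot]
  cup_alg := fun X x y hx hy => by
    show U.cup X 2 2 x y ∈ (U.truncAlgAt c).alg X 2
    rw [U.truncAlgAt_alg_of_le hc]
    rw [U.truncAlgAt_alg_of_le (le_trans (by norm_num : 1 ≤ 2) hc)] at hx hy
    exact M.cup_alg X x y hx hy
  lefschetz11 := fun X => by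
    show U.hodgeClassesOf X 1 ≤ (U.truncAlgAt c).alg X 1
    rw [U.truncAlgAt_alg_of_le (le_trans (by norm_num : 1 ≤ 2) hc)]
    exact M.lefschetz11 X
  cmAV := M.cmAV
  eigenLine := M.eigenLine
  alphaLine := M.alphaLine
  cmDominated := (U.truncAlgAt_fact_cmDominated_iff c).mpr M.cmDominated
  weilLine_rank := M.weilLine_rank
  weilLine_hodge := M.weilLine_hodge
  pms_dim := M.pms_dim
  lift := M.lift
  cup_comm1 := M.cup_comm1
  cup_interchange := M.cup_interchange
  kunneth1 := M.kunneth1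
  H1_rank := M.H1_rank
  H4_span := M.H4_span
  cmEnd := M.cmEnd
  conjIsogeny := M.conjIsogeny
  gysin_surface := fun S X f _ => ⟨0, Submodule.zero_mem _, fun y => by
    show U.tr S 4 _ = U.tr X _ _
    rw [h0, h0, LinearMap.zero_apply, LinearMap.zero_apply]⟩
  deg_diag := M.deg_diag
  algDuality := fun K Φ => by
    obtain ⟨D, hD, halg, hint⟩ := M.algDuality K Φ
    refine ⟨D, hD, ?_, hint⟩
    show ((U.truncAlgAt c).alg _ _).map D ≤ (U.truncAlgAt c).alg _ 2
    rw [U.truncAlgAt_alg_of_le hc]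
    exact (Submodule.map_mono (U.truncAlgAt_alg_le c _ _)).trans halg

/-! ### Unchanged statements -/

/-- (Ported verbatim from the HodgeCMPerL package; no docstring in the source.) -/
theorem truncAlgAt_weilFaceAlgebraic_iff {c : ℕ} (hc : 2 ≤ c) (K : CMField) (f : Face K) :
    (U.truncAlgAt c).WeilFaceAlgebraic K f ↔ U.WeilFaceAlgebraic K f := by
  show U.weilLine K f.corner ≤ (U.truncAlgAt c).alg _ 2 ↔ _
  rw [U.truncAlgAt_alg_of_le hc]
  rfl

/-- (Ported verbatim from the HodgeCMPerL package; no docstring in the source.) -/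
theorem truncAlgAt_w_rk4_iff {c : ℕ} (hc : 2 ≤ c) : (U.truncAlgAt c).W_RK4 ↔ U.W_RK4 :=
  forall₃_congr fun _ _ _ => forall_congr' fun f => U.truncAlgAt_weilFaceAlgebraic_iff hc _ f

set_option smartUnfolding false in
/-- (Ported verbatim from the HodgeCMPerL package; no docstring in the source.) -/
theorem truncAlgAt_pohlmannSpan_iff (c : ℕ) : (U.truncAlgAt c).PohlmannSpan ↔ U.PohlmannSpan := Iff.rfl
set_option smartUnfolding false in
/-- (Ported verbatim from the HodgeCMPerL package; no docstring in the source.) -/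
theorem truncAlgAt_pohlmannBasis_iff (c : ℕ) : (U.truncAlgAt c).PohlmannBasis ↔ U.PohlmannBasis := Iff.rfl
set_option smartUnfolding false in
/-- (Ported verbatim from the HodgeCMPerL package; no docstring in the source.) -/
theorem truncAlgAt_weightSpace (c : ℕ) (F : CMField) {n : ℕ} (Θ : Fin (n + 1) → CMType F)
    (S : Fin (n + 1) → Finset ((F : Type) →+* ℂ)) (k : ℕ) :
    (U.truncAlgAt c).weightSpace F Θ S k = U.weightSpace F Θ S k := rfl
set_option smartUnfolding false in
/-- (Ported verbatim from the HodgeCMPerL package; no docstring in the source.) -/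
theorem truncAlgAt_fact_cupExterior_iff (c : ℕ) : (U.truncAlgAt c).Fact_cupExterior ↔ U.Fact_cupExterior := Iff.rfl
/-- (Ported verbatim from the HodgeCMPerL package; no docstring in the source.) -/
theorem truncAlgAt_fact_cup_hodge_iff (c : ℕ) : (U.truncAlgAt c).Fact_cup_hodge ↔ U.Fact_cup_hodge := Iff.rfl
/-- (Ported verbatim from the HodgeCMPerL package; no docstring in the source.) -/
theorem truncAlgAt_fact_pull_H0_iff (c : ℕ) : (U.truncAlgAt c).Fact_pull_H0 ↔ U.Fact_pull_H0 := Iff.rfl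
/-- (Ported verbatim from the HodgeCMPerL package; no docstring in the source.) -/
theorem truncAlgAt_fact_hodge_F0_iff (c : ℕ) : (U.truncAlgAt c).Fact_hodge_F0 ↔ U.Fact_hodge_F0 := Iff.rfl
/-- (Ported verbatim from the HodgeCMPerL package; no docstring in the source.) -/
theorem truncAlgAt_fact_cupAssoc_iff (c : ℕ) : (U.truncAlgAt c).Fact_cupAssoc ↔ U.Fact_cupAssoc := Iff.rfl
/-- (Ported verbatim from the HodgeCMPerL package; no docstring in the source.) -/
theorem truncAlgAt_fact_dimProd_iff (c : ℕ) : (U.truncAlgAt c).Fact_dimProd ↔ U.Fact_dimProd := Iff.rfl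

set_option smartUnfolding false in
/-- F7d `Fact_gysinDescent` is inherited by every truncation (proof of `Fact_gysinDescent.truncAlg`, verbatim). -/
theorem Fact_gysinDescent.truncAlgAt (h : U.Fact_gysinDescent) (c : ℕ) : (U.truncAlgAt c).Fact_gysinDescent := by
  intro F n m Ξ pA pB hP ω hω
  obtain ⟨ha, hb⟩ := h F n m Ξ pA pB hP ω hω
  refine ⟨ha, fun p e he => ?_⟩
  by_cases hp : p + (U.truncAlgAt c).dim ((U.truncAlgAt c).cmProd F (blkB Ξ)) ≤ c
  · have he' := he
    rw [U.truncAlgAt_alg_of_le hp] at he'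
    show e ∈ (U.truncAlgAt c).alg _ p
    rw [U.truncAlgAt_alg_of_le (by omega)]
    exact hb p e he'
  · have he' := he
    rw [U.truncAlgAt_alg_of_lt (by omega), Submodule.mem_bot, LinearEquiv.map_eq_zero_iff] at he'
    have h0 : e = 0 := ha (2 * p) e he'
    rw [h0]
    exact Submodule.zero_mem _

/-! ### `HC` fails above the cut -/

variable {U}

/-- (Ported verbatim from the HodgeCMPerL package; no docstring in the source.) -/
theorem not_hc_truncAlgAt_of_ne_bot {c : ℕ} {X : U.Var} {p : ℕ} (hp : c < p) (h : U.hodgeClassesOf X p ≠ ⊥) :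
    ¬ (U.truncAlgAt c).HC X := by
  intro hc
  have h1 : U.hodgeClassesOf X p ≤ (U.truncAlgAt c).alg X p := hc p
  rw [U.truncAlgAt_alg_of_lt hp] at h1
  have h2 : U.hodgeClassesOf X p ≤ (⊥ : Submodule ℚ (U.Coh X (2 * p))) := h1
  exact h (eq_bot_iff.mpr h2)

/-! ### The witness: the top class of the power `A_{(F,Φ)}^{n+1}`, `F` Galois of degree `≥ 6` -/

section Witness

variable {F : CMField}

/-- The degree of the full weight on `n + 1` copies of `A_{(F,Φ)}`. -/
theorem sum_card_univ_pow (n : ℕ) :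
    (∑ _j : Fin (n + 1), (Finset.univ : Finset ((F : Type) →+* ℂ)).card) = (n + 1) * Module.finrank ℚ F := by
  rw [Finset.sum_const, Finset.card_univ, Fintype.card_fin, smul_eq_mul, Finset.card_univ, NumberField.Embeddings.card]

/-- The full weight on `A_{(F,Φ)}^{n+1}` is a Hodge weight of degree `(n+1)·[F:ℚ]/2` (Lefschetz character `0`). -/
theorem isHodgeWeight_univ_pow (n : ℕ) (Φ : CMType F) :
    IsHodgeWeight (fun _ : Fin (n + 1) => Φ) ((n + 1) * Module.finrank ℚ F / 2) (fun _ => Finset.univ) := by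
  have h := isHodgeWeight_of_lefChar_eq_zero (F := (F : Type)) (fun _ : Fin (n + 1) => Φ) (fun _ => Finset.univ)
    (lefChar_univ_eq_zero _)
  rwa [sum_card_univ_pow] at h

/-- (Ported verbatim from the HodgeCMPerL package; no docstring in the source.) -/
theorem two_mul_pow_degree_div_two (n : ℕ) (Φ : CMType F) :
    2 * ((n + 1) * Module.finrank ℚ F / 2) = (n + 1) * Module.finrank ℚ F := by
  have h := (isHodgeWeight_univ_pow n Φ).1
  rw [sum_card_univ_pow] at h
  omega

/-- `3(n+1) ≤ (n+1)·[F:ℚ]/2` when `[F:ℚ] ≥ 6`. -/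
theorem three_mul_le_pow_degree (n : ℕ) (h6 : 6 ≤ Module.finrank ℚ F) : 3 * (n + 1) ≤ (n + 1) * Module.finrank ℚ F / 2 := by
  have h : (n + 1) * 6 ≤ (n + 1) * Module.finrank ℚ F := Nat.mul_le_mul_left _ h6
  omega

/-- **The weight line of the full weight on `A_{(F,Φ)}^{n+1}` is nonzero** (`ModelAxioms` + N1). -/
theorem exists_weightVector_univ_pow (M : U.ModelAxioms) (hN1 : U.Fact_cupExterior) (h6 : 6 ≤ Module.finrank ℚ F)
    (n : ℕ) (Φ : CMType F) :
    ∃ x ∈ U.weightSpace F (fun _ : Fin (n + 1) => Φ) (fun _ => Finset.univ) (2 * ((n + 1) * Module.finrank ℚ F / 2)),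
      x ≠ 0 := by
  have hS := isHodgeWeight_univ_pow n Φ
  have hp : 0 < (n + 1) * Module.finrank ℚ F / 2 := lt_of_lt_of_le (by omega) (three_mul_le_pow_degree n h6)
  have h1 : Module.finrank ℂ
      (U.weightSpace F (fun _ : Fin (n + 1) => Φ) (fun _ => Finset.univ) (2 * ((n + 1) * Module.finrank ℚ F / 2))) = 1 :=
    finrank_weightSpace_of_isHodgeWeight M hN1 hp hS
  have hne : U.weightSpace F (fun _ : Fin (n + 1) => Φ) (fun _ => Finset.univ)
      (2 * ((n + 1) * Module.finrank ℚ F / 2)) ≠ ⊥ := by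
    intro hbot
    rw [hbot, finrank_bot] at h1
    exact zero_ne_one h1
  exact Submodule.exists_mem_ne_zero_of_ne_bot hne

/-- **`B^{(n+1)[F:ℚ]/2}(A_{(F,Φ)}^{n+1}) ≠ 0`** for `F` Galois (`ModelAxioms` + N1–N4, via Pohlmann's theorem). -/
theorem hodgeClassesOf_pow_ne_bot (M : U.ModelAxioms) (hN1 : U.Fact_cupExterior) (hN2 : U.Fact_cup_hodge)
    (hN3 : U.Fact_pull_H0) (hN4 : U.Fact_hodge_F0) [IsGalois ℚ F] (h6 : 6 ≤ Module.finrank ℚ F) (n : ℕ) (Φ : CMType F) :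
    U.hodgeClassesOf (U.cmProd F (fun _ : Fin (n + 1) => Φ)) ((n + 1) * Module.finrank ℚ F / 2) ≠ ⊥ := by
  intro hbot
  obtain ⟨x, hx, hx0⟩ := exists_weightVector_univ_pow M hN1 h6 n Φ
  have hB := pohlmannBasis_of_facts M hN1 hN2 hN3 hN4 F ‹_› n (fun _ : Fin (n + 1) => Φ)
    ((n + 1) * Module.finrank ℚ F / 2)
  rw [hbot, Submodule.baseChange_bot] at hB
  have hx' : x ∈ (⊥ : Submodule ℂ _) := by
    rw [hB]
    exact Submodule.mem_iSup_of_mem _ (Submodule.mem_iSup_of_mem (isHodgeWeight_univ_pow n Φ) hx)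
  exact hx0 ((Submodule.mem_bot ℂ).mp hx')

/-- **The top class of `A_{(F,Φ)}^{n+1}` is ALGEBRAIC** in a model with N1–N4 in which `HC` holds for CM products over `F`. -/
theorem alg_pow_ne_bot (M : U.ModelAxioms) (hN1 : U.Fact_cupExterior) (hN2 : U.Fact_cup_hodge)
    (hN3 : U.Fact_pull_H0) (hN4 : U.Fact_hodge_F0) [IsGalois ℚ F] (h6 : 6 ≤ Module.finrank ℚ F) (n : ℕ) (Φ : CMType F)
    (hHC : U.HC (U.cmProd F (fun _ : Fin (n + 1) => Φ))) :
    U.alg (U.cmProd F (fun _ : Fin (n + 1) => Φ)) ((n + 1) * Module.finrank ℚ F / 2) ≠ ⊥ := fun h =>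
  hodgeClassesOf_pow_ne_bot M hN1 hN2 hN3 hN4 h6 n Φ (eq_bot_iff.mpr (h ▸ hHC _))

set_option smartUnfolding false in
/-- **`HC(A_{(F,Φ)}^{c+1})` fails in the truncation at codimension `c`** (`F` Galois of degree `≥ 6`; `ModelAxioms` + N1–N4). -/
theorem not_hc_pow_truncAlgAt (M : U.ModelAxioms) (hN1 : U.Fact_cupExterior) (hN2 : U.Fact_cup_hodge)
    (hN3 : U.Fact_pull_H0) (hN4 : U.Fact_hodge_F0) [IsGalois ℚ F] (h6 : 6 ≤ Module.finrank ℚ F) (c : ℕ) (Φ : CMType F) :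
    ¬ (U.truncAlgAt c).HC (U.cmProd F (fun _ : Fin (c + 1) => Φ)) :=
  not_hc_truncAlgAt_of_ne_bot (lt_of_lt_of_le (by omega) (three_mul_le_pow_degree c h6))
    (hodgeClassesOf_pow_ne_bot M hN1 hN2 hN3 hN4 h6 c Φ)

end Witness

/-! ### The separations, for every `c ≥ 2` -/

section Separation

variable (M : U.ModelAxioms) (hN1 : U.Fact_cupExterior) (hN2 : U.Fact_cup_hodge) (hN3 : U.Fact_pull_H0)
  (hN4 : U.Fact_hodge_F0)
include M hN1

set_option smartUnfolding false in
/-- **`Qw8Sufficiency` FAILS in every truncation `c ≥ 2`** of a model with N1 and `W_RK4`: the faces of `ℚ(ζ₇)` stay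
algebraic, and the top class of `A_{(ℚ(ζ₇),Φ)}^{c+1}` is a nonzero weight vector of a Hodge weight with Lefschetz
character `0` in codimension `≥ 3(c+1) > c`, where `Alg ⊗ ℂ = 0`. -/
theorem not_qw8Sufficiency_truncAlgAt {c : ℕ} (hc : 2 ≤ c) (hW : U.W_RK4) : ¬ (U.truncAlgAt c).Qw8Sufficiency := by
  intro hQ
  obtain ⟨F, hG, h6, f, ι₁, -⟩ := HodgeCM.faceHypothesesInhabited
  haveI := hG
  obtain ⟨x, hx, hx0⟩ := exists_weightVector_univ_pow M hN1 h6 c f.Φ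
  have hfaces : ∀ f' : Face F, (U.truncAlgAt c).WeilFaceAlgebraic F f' :=
    fun f' => (U.truncAlgAt_weilFaceAlgebraic_iff hc F f').mpr (hW F hG h6 f')
  have hx' : (U.truncAlgAt c).IsWeightVector F (fun _ : Fin (c + 1) => f.Φ) (fun _ => Finset.univ)
      (2 * ((c + 1) * Module.finrank ℚ F / 2)) x := by
    rw [← mem_weightSpace_iff, truncAlgAt_weightSpace]
    exact hx
  have hmem := hQ F hG h6 hfaces c (fun _ => f.Φ) ((c + 1) * Module.finrank ℚ F / 2) (fun _ => Finset.univ) x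
    (isHodgeWeight_univ_pow c f.Φ) hx'
    ⟨ι₁, 0, Fin.elim0, Fin.elim0, by rw [lefChar_univ_eq_zero, Finset.univ_eq_empty, Finset.sum_empty]⟩
  rw [U.truncAlgAt_algC_of_lt (lt_of_lt_of_le (by omega) (three_mul_le_pow_degree c h6)), Submodule.mem_bot] at hmem
  exact hx0 hmem

include hN2 hN3 hN4

set_option smartUnfolding false in
/-- **`FaceReduction` FAILS in every truncation `c ≥ 2`** of a model with N1–N4 and `W_RK4`. -/
theorem not_faceReduction_truncAlgAt {c : ℕ} (hc : 2 ≤ c) (hW : U.W_RK4) : ¬ (U.truncAlgAt c).FaceReduction := by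
  obtain ⟨F, hG, h6, f, -⟩ := HodgeCM.faceHypothesesInhabited
  haveI := hG
  intro h
  exact not_hc_pow_truncAlgAt M hN1 hN2 hN3 hN4 h6 c f.Φ
    (h F hG h6 (fun f' => (U.truncAlgAt_weilFaceAlgebraic_iff hc F f').mpr (hW F hG h6 f')) c (fun _ => f.Φ))

set_option smartUnfolding false in
/-- `Lemma81` holds in every truncation — vacuously. -/
theorem lemma81_truncAlgAt (c : ℕ) : (U.truncAlgAt c).Lemma81 := by
  obtain ⟨F, hG, h6, f, -⟩ := HodgeCM.faceHypothesesInhabited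
  haveI := hG
  intro h
  exact absurd (h F hG h6 c (fun _ => f.Φ)) (not_hc_pow_truncAlgAt M hN1 hN2 hN3 hN4 h6 c f.Φ)

/-- **F4 `Fact_cupAlg` FAILS in every truncation `c ≥ 2`** of a model with N1–N4, F5, F7d, `Fact_dimProd`, `W_RK4` and
`tr = 0` (else the generic [QW8] route would prove `Qw8Sufficiency` there). -/
theorem not_fact_cupAlg_truncAlgAt {c : ℕ} (hc : 2 ≤ c) (h5 : U.Fact_cupAssoc) (h7d : U.Fact_gysinDescent)
    (hd : U.Fact_dimProd) (hW : U.W_RK4) (h0 : ∀ (X : U.Var) (k : ℕ), U.tr X k = 0) :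
    ¬ (U.truncAlgAt c).Fact_cupAlg := fun h4 =>
  not_qw8Sufficiency_truncAlgAt M hN1 hc hW
    (qw8Sufficiency_of_descentFacts (M.truncAlgAt hc h0) ((U.truncAlgAt_fact_cupExterior_iff c).mpr hN1)
      ((U.truncAlgAt_fact_cup_hodge_iff c).mpr hN2) ((U.truncAlgAt_fact_pull_H0_iff c).mpr hN3)
      ((U.truncAlgAt_fact_hodge_F0_iff c).mpr hN4) h4 ((U.truncAlgAt_fact_cupAssoc_iff c).mpr h5)
      (Fact_gysinDescent.truncAlgAt U h7d c) ((U.truncAlgAt_fact_dimProd_iff c).mpr hd))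

/-- The observable separating the cuts: "the top Hodge classes of the powers `A_{(ℚ(ζ₇),Φ)}^{k+1}` are algebraic"
(a statement INTERNAL to the universe `V`, so that it transports along an equality of universes). -/
def PowTopAlg (V : Universe) (k : ℕ) : Prop :=
  ∀ Φ : CMType cyclo7,
    V.hodgeClassesOf (V.cmProd cyclo7 (fun _ : Fin (k + 1) => Φ)) ((k + 1) * Module.finrank ℚ cyclo7 / 2) ≤
      V.alg (V.cmProd cyclo7 (fun _ : Fin (k + 1) => Φ)) ((k + 1) * Module.finrank ℚ cyclo7 / 2)


-- port_pkg: scope closed for this part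
end Separation
end Universe
end HodgeCM
end
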